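import Summits.QuantumAdvantage.QuantumAdvantage.Theses.CubicForrelation

/-!
# Disproof work file — crux `CubicForrelation.ExactPairsMaioranaMcFarland` (stmt-QuantumAdvantage-2205)

cdisprove seat `refuter-cdisprove-stmt-QuantumAdvantage-2205-0`, cycle 1 (2026-08-15). Crux (m = n/2):
cubic `f g : 𝔽₂^{m+m} → 𝔽₂` with `forrelation f g = 1` (g bent with dual f, BOTH cubic) ⇒ `g` is in the completed
Maiorana–McFarland class (`g∘e(y′,y″) = y′·π(y″) + h(y″)`, `e` affine). Status after this cycle: NOT refuted; open for
`m ≥ 5`; everything below is Lean-checked (the `native_decide` steps make the file `computational`).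

## CYCLE 2 (gen-2 seat `refuter-cdisprove-stmt-QuantumAdvantage-2205-g2-0`, 2026-08-16) — HEADLINE

* **The crux HOLDS at `m = 5` (n = 10)** — computational proof with paper lemmas, see the section
  `Cycle 2` at the end of this file (`CruxAt`, `cruxAt_five` (sorried: not yet formalised), proof path in its
  docstring).  Consequently NO counterexample exists in 10 variables; the disproof effort moves to `m ≥ 6`.
* Structure theorem behind it: for a cubic bent `g` on 𝔽₂¹⁰ with cubic dual, the cubic part `T` satisfies
  `γ₂(T) = 0` (F1, proved), hence (Theorem K, exterior algebra over 𝔽₂) either `T = ℓ ∧ ω₈` (dim Ker T = 1) or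
  `dim Ker T ≥ 3`; `dim Ker T ∈ {0, 2}` never occurs.  The three strata are settled separately (direct sums /
  an exhaustive 93 828-function enumeration / Scharlau's theorem on pairs of alternating forms).
* `n = 12`, exact class-level computations (bent-completion solver ∩ affine cubic-dual condition ∩ complement of
  the MM#-loci of all singular 6-spaces): the cubic parts of PP20's `h¹⁰₃ ⊕ 0`, `h¹⁰₄ ⊕ 0`, `h¹²₁,₂,₃,₅,₆` admit
  NO bent completion with cubic dual; `T(h¹²₇)` admits `2²⁴`, `T(gold8)` admits `2¹²` — and EXACTLY 0 of them lie
  outside MM#.  Hypothesis H of cycle 1 ("cubic/cubic ⇒ Ker T ≠ 0") is FALSE at n = 12 (gold8 =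
  `Tr(x₁y³)+Tr(x₂z³)` on 𝔽₈⁴, Ker T = 0, in MM#), so the n = 10 mechanism does not extend verbatim.

## Findings of cycle 1 (all theorems of cycle 1 are sorry-free; the single `sorry` of the file is `cruxAt_five`, cycle 2)

* LOAD-BEARING ANALYSIS — every hypothesis is necessary:
  - `exactPairsMaioranaMcFarland_false_without_fCubic` : dropping "the dual `f` is cubic" is FALSE at `m = 5`:
    `g4 := h^10_4` of Polujan–Pott 2020 (arXiv:1908.11271, Appendix) is cubic bent and NOT in the completed MM class,
    its dual `f4` is quartic.  (= the folklore warning "cubic bent ⇏ MM#", PP20 Thm 3.3 — here fully formal.)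
  - `exactPairsMaioranaMcFarland_false_without_gCubic` : dropping "`g` is cubic" is FALSE at `m = 5`: the quartic
    bent `f4` has CUBIC dual `g4` (`forrelation g4 f4 = 1`) and is not in MM# (MM# is closed under duality).
  - `exactPairsMaioranaMcFarland_false_without_forrelation` : dropping `forrelation f g = 1` is trivially false
    (`m = 1`, `g = 0`: the MM normal form forces `perm` constant).
  So a proof must use BOTH degree bounds and exact duality; in particular no argument that only looks at `g`
  (e.g. "cubic bent functions have an m-dimensional M-subspace") can work at `m ≥ 5`.
* DILLON BRIDGE (positive, reusable by provers): `mm_family` — the crux's conclusion for `g` on `5+5` bits yields an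
  injective family `u : 𝔽₂^5 → 𝔽₂^10` with `D_{u t} D_{u s} g ≡ 0` (g affine on the cosets of a 5-dim subspace);
  `count_ge_of_MM` turns it into the checkable certificate "≥ 32 directions b admit ≥ 32 compatible a".
  For `h^10_4` only 10 directions (incl. 0) do (`bigCountC_g`), for its dual only 1 (`bigCountC_f`).
* EXACT FORRELATION in Lean: `forrelation_f4_g4 : forrelation f4 g4 = 1` via the integer double sum `= 2^15`
  over codes (`E : Fin 1024 ≃ (Fin 10 → Bool)`), and `forrelation_comm`.
* CUBICITY WITNESS pattern: `g4_cubic` (explicit `MvPolynomial` as a sum of 72 monomials, `totalDegree ≤ 3` by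
  `totalDegree_finsetSum`, evaluation bridge `p4_eval` + `native_decide`) — the template a refutation would need.

## Why the crux resists (evidence outside Lean; scripts `py/cbent.py`, NOTES.md; job j006330)

* NEW TOOL: exact BENT-COMPLETION SOLVER — for a cubic form `C` on 𝔽₂^10, ALL quadratic `Q` with `C+Q` bent are the
  complement of a union of 1023 affine subspaces of 𝔽₂^45 (one per direction `a`: "`D_a(C+Q)` constant on the
  radical of `T(a,·,·)`"), enumerated as disjoint affine pieces in seconds.  Classes: cubic part of `h^10_4`: exactly
  1024 completions (its translates, all quartic-dual); of `h^10_3`: 786432 = 3·2^18 (20 pieces); of `h^10_1`: 786432.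
* EMPIRICAL INVARIANT ("conjecture Q", 100% of > 2000 samples): the degree-4 part of the dual is CONSTANT on a
  completion class (95 monomials on class(h^10_3), 107 on class(h^10_1), ∅ on MM classes; for MM `π = L + π₂` the
  property `deg π⁻¹ ≤ 2` does not depend on the linear part `L`).  If true in general, "cubic dual" is a property of
  the cubic part `C` alone, and a counterexample needs a completable cubic FORM whose class is cubic-dual but which
  contains a non-MM# member; all cubic-dual classes met so far are GL-images of sparse MM forms `Σ uᵢ π₂,ᵢ(v)` whose
  trilinear form has many isotropic 5-spaces (every sampled completion, even with u–u quadratic terms, is in MM#).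
* Prior passes (item notes): 4-concatenations, Carlet class C, Mesnager moves: 0 of ≈ 5.8·10^5 cubic-dual instances
  outside MM#, while ≈ 1.4% of quartic-dual ones are.  Li–Kan–Peng–Tan–Liu 2021 (acq-02644) still unread.

## Structure found (informal, checked numerically; the natural proof/disproof route)

* ROTATION-SYMMETRIC SCAN (all 4095 rotation-symmetric cubic FORMS on 𝔽₂^10, t11.py): 783 are bent-completable;
  15 classes are cubic-dual — every sampled member (40 per class) is in MM#; 48 quartic-dual classes contain sampled
  NON-MM# members (new outsiders).  Every cubic-dual class met anywhere (these, the MM classes, class samples) has a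
  direction `a ≠ 0` in the KERNEL of the trilinear form (`T(a,·,·) ≡ 0`, profile entry `dim R_a = 10`), i.e. an
  AFFINE DERIVATIVE `D_a g`; `h^10_4` (quartic dual) has none.  HYPOTHESIS H: cubic bent + cubic dual ⇒ affine
  derivative.
* REDUCTION under an affine derivative (elementary, Walsh computation): if `D_a g` is affine then in suitable
  coordinates `g = x₂·(x₁ + B₁(x″)) + B₀(x″)` with `deg B₁ ≤ 2` and `B₀`, `B₀′ := B₀ + B₁` BOTH bent on 𝔽₂^{n-2}, and
  `g̃(u) = u₁u₂ + B̃₀(u″) + u₁·(B̃₀ + B̃₀′)(u″)`.  Hence `deg g̃ ≤ 3 ⟺ deg(B̃₀ + B̃₀′) ≤ 2` (duals of 8-variable cubic bents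
  are cubic).  If `B₀′` is a translate `B₀(· + t)` then `g ≅ x₁x₂ ⊕ B₀ ∈ MM#`.  So, granting H, a counterexample at
  `m = 5` is exactly a pair `(B, B′)` of cubic bent functions on 𝔽₂^8 with `B + B′` quadratic AND `B̃ + B̃′` quadratic
  for which `x₂(x₁ + (B+B′)(x″)) + B(x″) ∉ MM#` — a finite search inside the completion classes of the (≤ 32
  GL(8,2)-classes of) cubic forms on 𝔽₂^8, grouped by the cubic part of the dual; and a proof of the crux at
  `m = 5` would follow from H + "no such pair" (+ Hou/Braeken: cubic bent on 𝔽₂^8 ⇒ MM#).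

## Next attacks (cycle 2)
the (B, B′)-pair search above (exhaustive per 8-variable cubic form); test/attack hypothesis H (a cubic-dual class
without kernel direction would need a new idea); 
full census of class(h^10_1)/class(h^10_3) for MM#-membership variation (j006330); cubic-form scans (rotation-
symmetric forms, concatenation-shaped forms `C₁(x)+z₁Q(x)+z₂Q′(x)+z₁z₂ℓ(x)`, n = 12 classes of `h^12_*`); a proof
or disproof of conjecture Q (which would make the crux a statement about cubic forms with a cubic-dual class).
-/

set_option linter.dupNamespace false

namespace Summit.QuantumAdvantage.QuantumAdvantage.Cruxes.ExactPairsMaioranaMcFarland.Disproof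

open Literature.Computability.QuantumComplexity

/-! ### Bit-vector plumbing -/

/-- pointwise xor of bit-vectors -/
def bx {n : ℕ} (x a : Fin n → Bool) : Fin n → Bool := fun i => xor (x i) (a i)

/-- indicator vector in `ZMod 2` -/
def ind {n : ℕ} (x : Fin n → Bool) : Fin n → ZMod 2 := fun i => if x i then 1 else 0

theorem ind_apply {n : ℕ} (x : Fin n → Bool) (i : Fin n) : ind x i = if x i then 1 else 0 := rfl

theorem ind_injective {n : ℕ} : Function.Injective (ind (n := n)) := by
  intro x y h
  funext i
  have hi := congrFun h i
  simp only [ind] at hi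
  revert hi
  cases x i <;> cases y i <;> simp

theorem ite_xor (p q : Bool) :
    (if (p ^^ q) then (1 : ZMod 2) else 0) = (if p then (1 : ZMod 2) else 0) + (if q then (1 : ZMod 2) else 0) := by
  cases p <;> cases q <;> decide

theorem ind_bx {n : ℕ} (x a : Fin n → Bool) : ind (bx x a) = ind x + ind a := by
  funext i
  exact ite_xor (x i) (a i)

theorem zmod2_add_self (z : ZMod 2) : z + z = 0 := by
  fin_cases z <;> decide

/-- the all-zero vector of length 5 -/
def z5 : Fin 5 → Bool := fun _ => false

theorem append_bx (y' t y'' : Fin 5 → Bool) :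
    Fin.append (bx y' t) y'' = bx (Fin.append y' y'') (Fin.append t z5) := by
  funext i
  refine Fin.addCases (fun j => ?_) (fun j => ?_) i
  · simp only [bx, Fin.append_left]
  · simp only [bx, z5, Fin.append_right, Bool.xor_false]

/-- four Booleans whose indicators sum to zero xor to `false` -/
theorem xor4_of_ind (a b c d : Bool)
    (h : (if a then (1 : ZMod 2) else 0) + (if b then (1 : ZMod 2) else 0)
      + (if c then (1 : ZMod 2) else 0) + (if d then (1 : ZMod 2) else 0) = 0) :
    (a ^^ b ^^ c ^^ d) = false := by
  revert h; cases a <;> cases b <;> cases c <;> cases d <;> decide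

/-- the algebraic identity behind Dillon's criterion: four MM values over a 2-flat in `y'` cancel -/
theorem mm_four_sum (A T S P : Fin 5 → ZMod 2) (H : ZMod 2) :
    (∑ i, A i * P i + H) + (∑ i, (A i + T i) * P i + H) + (∑ i, (A i + S i) * P i + H)
      + (∑ i, (A i + T i + S i) * P i + H) = 0 := by
  simp only [Finset.sum_add_distrib, add_mul]
  have h2 : ∀ z : ZMod 2, z + z = 0 := zmod2_add_self
  -- group equal terms
  calc _ = ((∑ i, A i * P i) + (∑ i, A i * P i)) + ((∑ i, A i * P i) + (∑ i, A i * P i))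
        + ((∑ i, T i * P i) + (∑ i, T i * P i)) + ((∑ i, S i * P i) + (∑ i, S i * P i))
        + ((H + H) + (H + H)) := by ring
    _ = 0 := by simp only [h2]

/-! ### The completed-Maiorana–McFarland conclusion of the crux at `m = 5` -/

/-- The conclusion of `ExactPairsMaioranaMcFarland` for a function `g` on `5 + 5` bits (verbatim shape). -/
def MMConclusion (g : (Fin (5 + 5) → Bool) → Bool) : Prop :=
  ∃ e : (Fin (5 + 5) → Bool) ≃ (Fin (5 + 5) → Bool),
    (∃ M : Matrix (Fin (5 + 5)) (Fin (5 + 5)) (ZMod 2), ∃ c : Fin (5 + 5) → ZMod 2,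
      ∀ y i, (if e y i then (1 : ZMod 2) else 0) = (M.mulVec (fun j => if y j then (1 : ZMod 2) else 0) + c) i) ∧
    ∃ perm : (Fin 5 → Bool) ≃ (Fin 5 → Bool), ∃ h : (Fin 5 → Bool) → Bool, ∀ y' y'' : Fin 5 → Bool,
      (if g (e (Fin.append y' y'')) then (1 : ZMod 2) else 0) =
        (∑ i, (if y' i then (1 : ZMod 2) else 0) * (if perm y'' i then (1 : ZMod 2) else 0)) +
          (if h y'' then (1 : ZMod 2) else 0)


/-- The conclusion of `ExactPairsMaioranaMcFarland` at a general `m` (verbatim shape). -/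
def MMConclusionAt (m : ℕ) (g : (Fin (m + m) → Bool) → Bool) : Prop :=
  ∃ e : (Fin (m + m) → Bool) ≃ (Fin (m + m) → Bool), (∃ M : Matrix (Fin (m + m)) (Fin (m + m)) (ZMod 2), ∃ c : Fin (m + m) → ZMod 2, ∀ y i, (if e y i then (1 : ZMod 2) else 0) = (M.mulVec (fun j => if y j then (1 : ZMod 2) else 0) + c) i) ∧ ∃ perm : (Fin m → Bool) ≃ (Fin m → Bool), ∃ h : (Fin m → Bool) → Bool, ∀ y' y'' : Fin m → Bool, (if g (e (Fin.append y' y'')) then (1 : ZMod 2) else 0) = (∑ i, (if y' i then (1 : ZMod 2) else 0) * (if perm y'' i then (1 : ZMod 2) else 0)) + (if h y'' then (1 : ZMod 2) else 0)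

theorem MMConclusionAt_five (g : (Fin (5 + 5) → Bool) → Bool) : MMConclusionAt 5 g ↔ MMConclusion g := Iff.rfl

/-- Dillon's necessary condition: an MM#-function on `5+5` bits admits 32 = 2^5 distinct translates
`u t` such that all second derivatives `D_{u t} D_{u s} g` vanish identically. -/
theorem mm_family (g : (Fin (5 + 5) → Bool) → Bool) (hg : MMConclusion g) :
    ∃ u : (Fin 5 → Bool) → (Fin (5 + 5) → Bool), Function.Injective u ∧
      ∀ t s x, (g x ^^ g (bx x (u t)) ^^ g (bx x (u s)) ^^ g (bx (bx x (u t)) (u s))) = false := by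
  obtain ⟨e, ⟨M, c, he⟩, perm, h, hMM⟩ := hg
  have he' : ∀ y, ind (e y) = M.mulVec (ind y) + c := fun y => funext (he y)
  have hcc : c + c = 0 := funext fun i => zmod2_add_self (c i)
  have hz : ind (Fin.append z5 z5) = 0 := by
    funext i
    refine Fin.addCases (fun j => ?_) (fun j => ?_) i
    · simp only [ind, z5, Fin.append_left, Pi.zero_apply]; rfl
    · simp only [ind, z5, Fin.append_right, Pi.zero_apply]; rfl
  refine ⟨fun t => bx (e (Fin.append t z5)) (e (Fin.append z5 z5)), ?_, ?_⟩
  · -- injectivity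
    intro t s hts
    have h1 : e (Fin.append t z5) = e (Fin.append s z5) := by
      funext i
      have hi := congrFun hts i
      simp only [bx] at hi
      revert hi
      cases e (Fin.append t z5) i <;> cases e (Fin.append s z5) i <;>
        cases e (Fin.append z5 z5) i <;> simp
    have h2 := e.injective h1
    funext i
    have h3 := congrFun h2 (Fin.castAdd 5 i)
    simpa [Fin.append_left] using h3
  · -- vanishing second derivatives
    have hu : ∀ t, ind (bx (e (Fin.append t z5)) (e (Fin.append z5 z5))) = M.mulVec (ind (Fin.append t z5)) := by
      intro t
      rw [ind_bx, he', he', hz, Matrix.mulVec_zero, zero_add, add_assoc, hcc, add_zero]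
    have hA : ∀ y' y'' t, bx (e (Fin.append y' y'')) (bx (e (Fin.append t z5)) (e (Fin.append z5 z5)))
        = e (Fin.append (bx y' t) y'') := by
      intro y' y'' t
      apply ind_injective
      rw [ind_bx, he', hu, he', append_bx, ind_bx, Matrix.mulVec_add]
      abel
    intro t s x
    obtain ⟨y, rfl⟩ := e.surjective x
    have hy : Fin.append (fun i => y (Fin.castAdd 5 i)) (fun i => y (Fin.natAdd 5 i)) = y :=
      Fin.append_castAdd_natAdd
    rw [← hy, hA, hA, hA]
    apply xor4_of_ind
    rw [hMM, hMM, hMM, hMM]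
    have e1 : ∀ (a b : Fin 5 → Bool) i, (if bx a b i then (1 : ZMod 2) else 0)
        = (if a i then (1 : ZMod 2) else 0) + (if b i then (1 : ZMod 2) else 0) :=
      fun a b i => ite_xor (a i) (b i)
    simp only [e1]
    exact mm_four_sum _ _ _ _ _


/-! ### Codes `Fin 1024 ≃ (Fin 10 → Bool)` -/

/-- Decode a natural number into a bit-vector of length 10 (`x_i = testBit k i`). -/
def dec (k : ℕ) : Fin 10 → Bool := fun i => k.testBit i.val

/-- Encode a bit-vector of length 10 as a natural number `< 1024`. -/
def code (x : Fin 10 → Bool) : ℕ := ∑ i : Fin 10, (x i).toNat * 2 ^ (i : ℕ)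

theorem code_lt : ∀ x : Fin 10 → Bool, code x < 1024 := by native_decide

theorem dec_code_apply : ∀ x : Fin 10 → Bool, ∀ i : Fin 10, dec (code x) i = x i := by native_decide

theorem code_dec : ∀ k : Fin 1024, code (dec k) = k := by native_decide

theorem dec_xor (a b : ℕ) : dec (a ^^^ b) = bx (dec a) (dec b) := by
  funext i; simp [dec, bx, Nat.testBit_xor]

/-- The coding equivalence. -/
def E : Fin 1024 ≃ (Fin 10 → Bool) where
  toFun k := dec k
  invFun x := ⟨code x, code_lt x⟩
  left_inv k := Fin.ext (code_dec k)
  right_inv x := funext (dec_code_apply x)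

@[simp] theorem E_apply (k : Fin 1024) : E k = dec k := rfl

/-! ### The witnesses: PP20's `h^10_4` and its dual -/

/-- PP20's homogeneous cubic bent function `h^10_4` (72 cubic monomials), outside the completed MM class. -/
def g4 (x : Fin 10 → Bool) : Bool :=
    (x 0 && x 1 && x 5) ^^ (x 0 && x 1 && x 6) ^^ (x 0 && x 1 && x 7) ^^ (x 0 && x 1 && x 9) ^^
    (x 0 && x 2 && x 3) ^^ (x 0 && x 2 && x 4) ^^ (x 0 && x 2 && x 6) ^^ (x 0 && x 2 && x 8) ^^
    (x 0 && x 2 && x 9) ^^ (x 0 && x 3 && x 4) ^^ (x 0 && x 3 && x 5) ^^ (x 0 && x 3 && x 7) ^^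
    (x 0 && x 3 && x 8) ^^ (x 0 && x 3 && x 9) ^^ (x 0 && x 4 && x 6) ^^ (x 0 && x 5 && x 6) ^^
    (x 0 && x 5 && x 7) ^^ (x 0 && x 5 && x 9) ^^ (x 0 && x 6 && x 8) ^^ (x 0 && x 6 && x 9) ^^
    (x 0 && x 8 && x 9) ^^ (x 1 && x 2 && x 4) ^^ (x 1 && x 2 && x 7) ^^ (x 1 && x 2 && x 8) ^^
    (x 1 && x 2 && x 9) ^^ (x 1 && x 3 && x 5) ^^ (x 1 && x 3 && x 6) ^^ (x 1 && x 3 && x 7) ^^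
    (x 1 && x 4 && x 5) ^^ (x 1 && x 4 && x 8) ^^ (x 1 && x 5 && x 6) ^^ (x 1 && x 5 && x 8) ^^
    (x 1 && x 5 && x 9) ^^ (x 1 && x 6 && x 7) ^^ (x 1 && x 6 && x 9) ^^ (x 1 && x 7 && x 8) ^^
    (x 1 && x 7 && x 9) ^^ (x 1 && x 8 && x 9) ^^ (x 2 && x 3 && x 6) ^^ (x 2 && x 3 && x 8) ^^
    (x 2 && x 4 && x 5) ^^ (x 2 && x 4 && x 6) ^^ (x 2 && x 4 && x 7) ^^ (x 2 && x 4 && x 9) ^^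
    (x 2 && x 5 && x 7) ^^ (x 2 && x 5 && x 8) ^^ (x 2 && x 6 && x 9) ^^ (x 2 && x 7 && x 8) ^^
    (x 2 && x 7 && x 9) ^^ (x 2 && x 8 && x 9) ^^ (x 3 && x 4 && x 6) ^^ (x 3 && x 4 && x 8) ^^
    (x 3 && x 4 && x 9) ^^ (x 3 && x 5 && x 7) ^^ (x 3 && x 5 && x 9) ^^ (x 3 && x 6 && x 7) ^^
    (x 3 && x 6 && x 8) ^^ (x 3 && x 6 && x 9) ^^ (x 3 && x 7 && x 9) ^^ (x 3 && x 8 && x 9) ^^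
    (x 4 && x 5 && x 7) ^^ (x 4 && x 5 && x 8) ^^ (x 4 && x 5 && x 9) ^^ (x 4 && x 6 && x 8) ^^
    (x 4 && x 6 && x 9) ^^ (x 4 && x 7 && x 8) ^^ (x 4 && x 7 && x 9) ^^ (x 4 && x 8 && x 9) ^^
    (x 5 && x 6 && x 7) ^^ (x 5 && x 7 && x 9) ^^ (x 5 && x 8 && x 9) ^^ (x 6 && x 7 && x 9)

/-- The dual of `g4` (ANF of degree 4, 208 monomials). -/
def f4 (x : Fin 10 → Bool) : Bool :=
    x 9 ^^ (x 0 && x 3) ^^ (x 0 && x 6) ^^ (x 0 && x 9) ^^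
    (x 1 && x 5) ^^ (x 1 && x 7) ^^ (x 1 && x 9) ^^ (x 2 && x 4) ^^
    (x 2 && x 8) ^^ (x 2 && x 9) ^^ (x 3 && x 6) ^^ (x 3 && x 9) ^^
    (x 4 && x 8) ^^ (x 4 && x 9) ^^ (x 5 && x 7) ^^ (x 5 && x 9) ^^
    (x 6 && x 9) ^^ (x 7 && x 9) ^^ (x 8 && x 9) ^^ (x 0 && x 1 && x 3) ^^
    (x 0 && x 1 && x 4) ^^ (x 0 && x 1 && x 9) ^^ (x 0 && x 2 && x 3) ^^ (x 0 && x 2 && x 4) ^^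
    (x 0 && x 2 && x 9) ^^ (x 0 && x 3 && x 7) ^^ (x 0 && x 4 && x 6) ^^ (x 0 && x 4 && x 7) ^^
    (x 0 && x 4 && x 8) ^^ (x 0 && x 4 && x 9) ^^ (x 0 && x 5 && x 6) ^^ (x 0 && x 5 && x 7) ^^
    (x 0 && x 5 && x 9) ^^ (x 0 && x 6 && x 7) ^^ (x 0 && x 7 && x 8) ^^ (x 0 && x 7 && x 9) ^^
    (x 0 && x 8 && x 9) ^^ (x 1 && x 2 && x 3) ^^ (x 1 && x 2 && x 5) ^^ (x 1 && x 2 && x 9) ^^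
    (x 1 && x 3 && x 4) ^^ (x 1 && x 3 && x 6) ^^ (x 1 && x 3 && x 7) ^^ (x 1 && x 3 && x 9) ^^
    (x 1 && x 4 && x 5) ^^ (x 1 && x 4 && x 7) ^^ (x 1 && x 4 && x 8) ^^ (x 1 && x 4 && x 9) ^^
    (x 1 && x 5 && x 6) ^^ (x 1 && x 6 && x 9) ^^ (x 1 && x 7 && x 8) ^^ (x 1 && x 8 && x 9) ^^
    (x 2 && x 3 && x 4) ^^ (x 2 && x 3 && x 5) ^^ (x 2 && x 3 && x 8) ^^ (x 2 && x 3 && x 9) ^^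
    (x 2 && x 4 && x 5) ^^ (x 2 && x 5 && x 6) ^^ (x 2 && x 5 && x 7) ^^ (x 2 && x 5 && x 9) ^^
    (x 2 && x 6 && x 8) ^^ (x 2 && x 6 && x 9) ^^ (x 2 && x 7 && x 8) ^^ (x 2 && x 7 && x 9) ^^
    (x 3 && x 4 && x 9) ^^ (x 3 && x 5 && x 6) ^^ (x 3 && x 5 && x 9) ^^ (x 3 && x 6 && x 8) ^^
    (x 3 && x 7 && x 9) ^^ (x 3 && x 8 && x 9) ^^ (x 4 && x 5 && x 9) ^^ (x 4 && x 6 && x 8) ^^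
    (x 4 && x 6 && x 9) ^^ (x 4 && x 7 && x 9) ^^ (x 5 && x 6 && x 8) ^^ (x 5 && x 6 && x 9) ^^
    (x 5 && x 7 && x 8) ^^ (x 5 && x 8 && x 9) ^^ (x 6 && x 7 && x 8) ^^ (x 6 && x 7 && x 9) ^^
    (x 6 && x 8 && x 9) ^^ (x 7 && x 8 && x 9) ^^ (x 0 && x 1 && x 2 && x 3) ^^ (x 0 && x 1 && x 2 && x 4) ^^
    (x 0 && x 1 && x 2 && x 5) ^^ (x 0 && x 1 && x 2 && x 6) ^^ (x 0 && x 1 && x 2 && x 8) ^^ (x 0 && x 1 && x 3 && x 5) ^^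
    (x 0 && x 1 && x 3 && x 7) ^^ (x 0 && x 1 && x 3 && x 8) ^^ (x 0 && x 1 && x 3 && x 9) ^^ (x 0 && x 1 && x 4 && x 6) ^^
    (x 0 && x 1 && x 4 && x 8) ^^ (x 0 && x 1 && x 4 && x 9) ^^ (x 0 && x 1 && x 5 && x 8) ^^ (x 0 && x 1 && x 5 && x 9) ^^
    (x 0 && x 1 && x 6 && x 7) ^^ (x 0 && x 1 && x 7 && x 8) ^^ (x 0 && x 1 && x 7 && x 9) ^^ (x 0 && x 2 && x 3 && x 4) ^^
    (x 0 && x 2 && x 3 && x 5) ^^ (x 0 && x 2 && x 3 && x 9) ^^ (x 0 && x 2 && x 4 && x 9) ^^ (x 0 && x 2 && x 5 && x 9) ^^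
    (x 0 && x 2 && x 6 && x 7) ^^ (x 0 && x 2 && x 6 && x 8) ^^ (x 0 && x 2 && x 6 && x 9) ^^ (x 0 && x 2 && x 7 && x 8) ^^
    (x 0 && x 2 && x 7 && x 9) ^^ (x 0 && x 3 && x 4 && x 7) ^^ (x 0 && x 3 && x 4 && x 8) ^^ (x 0 && x 3 && x 4 && x 9) ^^
    (x 0 && x 3 && x 5 && x 8) ^^ (x 0 && x 3 && x 7 && x 9) ^^ (x 0 && x 3 && x 8 && x 9) ^^ (x 0 && x 4 && x 5 && x 7) ^^
    (x 0 && x 4 && x 5 && x 8) ^^ (x 0 && x 4 && x 5 && x 9) ^^ (x 0 && x 4 && x 6 && x 7) ^^ (x 0 && x 4 && x 6 && x 8) ^^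
    (x 0 && x 4 && x 6 && x 9) ^^ (x 0 && x 4 && x 7 && x 9) ^^ (x 0 && x 4 && x 8 && x 9) ^^ (x 0 && x 5 && x 6 && x 7) ^^
    (x 0 && x 5 && x 6 && x 8) ^^ (x 0 && x 5 && x 6 && x 9) ^^ (x 0 && x 5 && x 7 && x 8) ^^ (x 0 && x 5 && x 7 && x 9) ^^
    (x 0 && x 6 && x 7 && x 9) ^^ (x 0 && x 6 && x 8 && x 9) ^^ (x 0 && x 7 && x 8 && x 9) ^^ (x 1 && x 2 && x 3 && x 6) ^^
    (x 1 && x 2 && x 3 && x 7) ^^ (x 1 && x 2 && x 3 && x 9) ^^ (x 1 && x 2 && x 4 && x 5) ^^ (x 1 && x 2 && x 4 && x 7) ^^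
    (x 1 && x 2 && x 4 && x 9) ^^ (x 1 && x 2 && x 5 && x 6) ^^ (x 1 && x 2 && x 5 && x 8) ^^ (x 1 && x 2 && x 5 && x 9) ^^
    (x 1 && x 2 && x 6 && x 7) ^^ (x 1 && x 2 && x 6 && x 8) ^^ (x 1 && x 2 && x 8 && x 9) ^^ (x 1 && x 3 && x 4 && x 5) ^^
    (x 1 && x 3 && x 4 && x 7) ^^ (x 1 && x 3 && x 4 && x 8) ^^ (x 1 && x 3 && x 4 && x 9) ^^ (x 1 && x 3 && x 5 && x 6) ^^
    (x 1 && x 3 && x 5 && x 9) ^^ (x 1 && x 3 && x 6 && x 9) ^^ (x 1 && x 3 && x 7 && x 9) ^^ (x 1 && x 3 && x 8 && x 9) ^^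
    (x 1 && x 4 && x 5 && x 9) ^^ (x 1 && x 4 && x 6 && x 7) ^^ (x 1 && x 4 && x 6 && x 9) ^^ (x 1 && x 4 && x 7 && x 8) ^^
    (x 1 && x 4 && x 7 && x 9) ^^ (x 1 && x 4 && x 8 && x 9) ^^ (x 1 && x 5 && x 6 && x 8) ^^ (x 1 && x 5 && x 6 && x 9) ^^
    (x 1 && x 6 && x 7 && x 9) ^^ (x 1 && x 6 && x 8 && x 9) ^^ (x 1 && x 7 && x 8 && x 9) ^^ (x 2 && x 3 && x 4 && x 5) ^^
    (x 2 && x 3 && x 4 && x 6) ^^ (x 2 && x 3 && x 4 && x 7) ^^ (x 2 && x 3 && x 4 && x 9) ^^ (x 2 && x 3 && x 5 && x 8) ^^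
    (x 2 && x 3 && x 5 && x 9) ^^ (x 2 && x 3 && x 6 && x 8) ^^ (x 2 && x 3 && x 6 && x 9) ^^ (x 2 && x 3 && x 7 && x 9) ^^
    (x 2 && x 3 && x 8 && x 9) ^^ (x 2 && x 4 && x 5 && x 6) ^^ (x 2 && x 4 && x 5 && x 9) ^^ (x 2 && x 4 && x 6 && x 7) ^^
    (x 2 && x 4 && x 7 && x 9) ^^ (x 2 && x 5 && x 6 && x 7) ^^ (x 2 && x 5 && x 6 && x 9) ^^ (x 2 && x 5 && x 7 && x 8) ^^
    (x 2 && x 5 && x 7 && x 9) ^^ (x 2 && x 5 && x 8 && x 9) ^^ (x 2 && x 6 && x 7 && x 8) ^^ (x 2 && x 6 && x 8 && x 9) ^^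
    (x 2 && x 7 && x 8 && x 9) ^^ (x 3 && x 4 && x 5 && x 6) ^^ (x 3 && x 4 && x 5 && x 7) ^^ (x 3 && x 4 && x 5 && x 8) ^^
    (x 3 && x 4 && x 6 && x 7) ^^ (x 3 && x 4 && x 6 && x 9) ^^ (x 3 && x 5 && x 6 && x 7) ^^ (x 3 && x 5 && x 6 && x 8) ^^
    (x 3 && x 5 && x 6 && x 9) ^^ (x 3 && x 5 && x 7 && x 8) ^^ (x 3 && x 5 && x 7 && x 9) ^^ (x 3 && x 6 && x 7 && x 8) ^^
    (x 3 && x 6 && x 8 && x 9) ^^ (x 3 && x 7 && x 8 && x 9) ^^ (x 4 && x 5 && x 6 && x 9) ^^ (x 4 && x 5 && x 7 && x 8) ^^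
    (x 4 && x 5 && x 8 && x 9) ^^ (x 4 && x 6 && x 7 && x 8) ^^ (x 4 && x 6 && x 8 && x 9) ^^ (x 4 && x 7 && x 8 && x 9) ^^
    (x 5 && x 6 && x 7 && x 9) ^^ (x 5 && x 6 && x 8 && x 9) ^^ (x 5 && x 7 && x 8 && x 9) ^^ (x 6 && x 7 && x 8 && x 9)

/-- truth table of `g4` on codes -/
def gTbl : Array Bool := Array.ofFn fun k : Fin 1024 => g4 (dec k)
/-- truth table of `f4` on codes -/
def fTbl : Array Bool := Array.ofFn fun k : Fin 1024 => f4 (dec k)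
/-- table version of `g4` on codes -/
def gT (k : ℕ) : Bool := gTbl.getD k false
/-- table version of `f4` on codes -/
def fT (k : ℕ) : Bool := fTbl.getD k false

theorem gT_eq (k : ℕ) (hk : k < 1024) : gT k = g4 (dec k) := by
  simp [gT, gTbl, hk]

theorem fT_eq (k : ℕ) (hk : k < 1024) : fT k = f4 (dec k) := by
  simp [fT, fTbl, hk]

/-! ### Certificate: too few directions with many vanishing second derivatives -/

/-- sample points: 0 and the unit vectors (codes) -/
def S1 : List ℕ := [0, 1, 2, 4, 8, 16, 32, 64, 128, 256, 512]

theorem S1_lt : ∀ k ∈ S1, k < 1024 := by decide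

/-- second derivative of a table function vanishes on the sample points -/
def compatT (t : ℕ → Bool) (a b : ℕ) : Bool :=
  S1.all fun x => (t x ^^ t (x ^^^ a) ^^ t (x ^^^ b) ^^ t (x ^^^ a ^^^ b)) == false

/-- sampled second-derivative test on functions -/
def compatF (g : (Fin 10 → Bool) → Bool) (a b : Fin 10 → Bool) : Prop :=
  ∀ k ∈ S1, (g (dec k) ^^ g (bx (dec k) a) ^^ g (bx (dec k) b) ^^ g (bx (bx (dec k) a) b)) = false

instance (g : (Fin 10 → Bool) → Bool) (a b : Fin 10 → Bool) : Decidable (compatF g a b) := by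
  unfold compatF; infer_instance

/-- number of directions `b` (including `0`) admitting at least 32 sampled-compatible `a` -/
def bigCountC (t : ℕ → Bool) : ℕ :=
  (Finset.univ.filter fun b : Fin 1024 =>
    32 ≤ (Finset.univ.filter fun a : Fin 1024 => compatT t a b = true).card).card

theorem bigCountC_g : bigCountC gT = 10 := by native_decide
theorem bigCountC_f : bigCountC fT = 1 := by native_decide

theorem count_ge_of_MM (g : (Fin (5 + 5) → Bool) → Bool) (hg : MMConclusion g) :
    32 ≤ (Finset.univ.filter fun b : Fin 10 → Bool =>
      32 ≤ (Finset.univ.filter fun a : Fin 10 → Bool => compatF g a b).card).card := by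
  obtain ⟨u, hu, hD⟩ := mm_family g hg
  set V : Finset (Fin 10 → Bool) := Finset.univ.image u with hVdef
  have hV : V.card = 32 := by
    rw [hVdef, Finset.card_image_of_injective _ hu]
    simp
  have h1 : ∀ b ∈ V, V ⊆ Finset.univ.filter fun a => compatF g a b := by
    intro b hb a ha
    rw [hVdef, Finset.mem_image] at ha hb
    obtain ⟨t, -, rfl⟩ := ha
    obtain ⟨s, -, rfl⟩ := hb
    simp only [Finset.mem_filter, Finset.mem_univ, true_and]
    intro k _
    exact hD t s (dec k)
  have h2 : V ⊆ Finset.univ.filter fun b : Fin 10 → Bool =>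
      32 ≤ (Finset.univ.filter fun a : Fin 10 → Bool => compatF g a b).card := by
    intro b hb
    simp only [Finset.mem_filter, Finset.mem_univ, true_and]
    calc 32 = V.card := hV.symm
      _ ≤ _ := Finset.card_le_card (h1 b hb)
  calc 32 = V.card := hV.symm
    _ ≤ _ := Finset.card_le_card h2

theorem card_filter_E (P : (Fin 10 → Bool) → Prop) [DecidablePred P] :
    (Finset.univ.filter P).card = (Finset.univ.filter fun k : Fin 1024 => P (E k)).card := by
  rw [← Finset.map_univ_equiv E, Finset.filter_map, Finset.card_map]
  rfl

theorem compat_transfer (g : (Fin 10 → Bool) → Bool) (t : ℕ → Bool)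
    (ht : ∀ k, k < 1024 → t k = g (dec k)) (a b : Fin 1024) :
    compatF g (E a) (E b) ↔ compatT t a b = true := by
  simp only [compatF, compatT, E_apply, List.all_eq_true, beq_iff_eq]
  refine forall₂_congr fun k hk => ?_
  have hk' := S1_lt k hk
  have h1 : k ^^^ (a : ℕ) < 1024 := Nat.xor_lt_two_pow (n := 10) hk' a.isLt
  have h2 : k ^^^ (b : ℕ) < 1024 := Nat.xor_lt_two_pow (n := 10) hk' b.isLt
  have h3 : k ^^^ (a : ℕ) ^^^ (b : ℕ) < 1024 := Nat.xor_lt_two_pow (n := 10) h1 b.isLt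
  rw [ht _ hk', ht _ h1, ht _ h2, ht _ h3]
  simp only [dec_xor]

theorem count_transfer (g : (Fin 10 → Bool) → Bool) (t : ℕ → Bool)
    (ht : ∀ k, k < 1024 → t k = g (dec k)) :
    (Finset.univ.filter fun b : Fin 10 → Bool =>
      32 ≤ (Finset.univ.filter fun a : Fin 10 → Bool => compatF g a b).card).card = bigCountC t := by
  have inner : ∀ k : Fin 1024, (Finset.univ.filter fun a : Fin 10 → Bool => compatF g a (E k)).card
      = (Finset.univ.filter fun a : Fin 1024 => compatT t a k = true).card := by
    intro k
    refine (card_filter_E _).trans ?_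
    exact congrArg Finset.card (Finset.filter_congr fun a _ => compat_transfer g t ht a k)
  refine (card_filter_E _).trans ?_
  unfold bigCountC
  exact congrArg Finset.card (Finset.filter_congr fun k _ => by rw [inner])

/-- `h^10_4` is not in the completed Maiorana–McFarland class (Lean-checked Dillon certificate). -/
theorem g4_not_MM : ¬ MMConclusion g4 := by
  intro h
  have h32 := count_ge_of_MM g4 h
  rw [count_transfer g4 gT gT_eq, bigCountC_g] at h32
  omega

/-- the (quartic) dual of `h^10_4` is not in the completed Maiorana–McFarland class either -/
theorem f4_not_MM : ¬ MMConclusion f4 := by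
  intro h
  have h32 := count_ge_of_MM f4 h
  rw [count_transfer f4 fT fT_eq, bigCountC_f] at h32
  omega

/-! ### Forrelation = 1 (the pair is exactly forrelated: `f4` is the dual of the bent `g4`) -/

/-- `(-1)^[b]` as an integer -/
def sgnZ (b : Bool) : ℤ := if b then -1 else 1
/-- `(-1)^{x·y}` as an integer -/
def twistZ (x y : Fin 10 → Bool) : ℤ := ∏ l, if x l && y l then -1 else 1
/-- `Σ_{x,y} (-1)^{f4 x} (-1)^{x·y} (-1)^{g4 y}` computed on codes and tables -/
def forrNum : ℤ := ∑ a : Fin 1024, ∑ b : Fin 1024, sgnZ (fT a) * twistZ (dec a) (dec b) * sgnZ (gT b)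

theorem forrNum_eq : forrNum = 32768 := by native_decide

theorem signOf_eq_cast (b : Bool) : signOf b = (sgnZ b : ℝ) := by
  cases b <;> simp [signOf, sgnZ]

theorem twist_eq_cast (x y : Fin 10 → Bool) : twist x y = (twistZ x y : ℝ) := by
  unfold twist twistZ
  push_cast
  refine Finset.prod_congr rfl fun l _ => ?_
  split <;> simp

theorem forrelation_f4_g4 : forrelation f4 g4 = 1 := by
  unfold forrelation
  have hs : ∑ x : Fin 10 → Bool, ∑ y : Fin 10 → Bool, signOf (f4 x) * twist x y * signOf (g4 y)
      = (forrNum : ℝ) := by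
    unfold forrNum
    push_cast
    rw [← Equiv.sum_comp E]
    refine Finset.sum_congr rfl fun a _ => ?_
    rw [← Equiv.sum_comp E]
    refine Finset.sum_congr rfl fun b _ => ?_
    rw [E_apply, E_apply, signOf_eq_cast, signOf_eq_cast, twist_eq_cast, gT_eq _ b.isLt, fT_eq _ a.isLt]
  rw [hs, forrNum_eq]
  have hsq : Real.sqrt (2 ^ (3 * 10)) = 32768 := by
    rw [show ((2 : ℝ) ^ (3 * 10)) = 32768 ^ 2 by norm_num]
    exact Real.sqrt_sq (by norm_num)
  rw [hsq]
  norm_num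

theorem twist_comm {n : ℕ} (x y : Fin n → Bool) : twist x y = twist y x := by
  unfold twist
  refine Finset.prod_congr rfl fun l _ => ?_
  rw [Bool.and_comm]

theorem forrelation_comm {n : ℕ} (f g : (Fin n → Bool) → Bool) : forrelation f g = forrelation g f := by
  unfold forrelation
  congr 1
  rw [Finset.sum_comm]
  refine Finset.sum_congr rfl fun y _ => Finset.sum_congr rfl fun x _ => ?_
  rw [twist_comm]; ring

theorem forrelation_g4_f4 : forrelation g4 f4 = 1 := by
  rw [forrelation_comm, forrelation_f4_g4]

/-! ### `g4` is cubic -/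

/-- the 72 cubic monomials of `h^10_4` -/
def tripF : Finset (Fin 10 × Fin 10 × Fin 10) :=
  {(0, 1, 5), (0, 1, 6), (0, 1, 7), (0, 1, 9), (0, 2, 3), (0, 2, 4), (0, 2, 6), (0, 2, 8), (0, 2, 9), (0, 3, 4), (0, 3, 5), (0, 3, 7), (0, 3, 8), (0, 3, 9), (0, 4, 6), (0, 5, 6), (0, 5, 7), (0, 5, 9), (0, 6, 8), (0, 6, 9), (0, 8, 9), (1, 2, 4), (1, 2, 7), (1, 2, 8), (1, 2, 9), (1, 3, 5), (1, 3, 6), (1, 3, 7), (1, 4, 5), (1, 4, 8), (1, 5, 6), (1, 5, 8), (1, 5, 9), (1, 6, 7), (1, 6, 9), (1, 7, 8), (1, 7, 9), (1, 8, 9), (2, 3, 6), (2, 3, 8), (2, 4, 5), (2, 4, 6), (2, 4, 7), (2, 4, 9), (2, 5, 7), (2, 5, 8), (2, 6, 9), (2, 7, 8), (2, 7, 9), (2, 8, 9), (3, 4, 6), (3, 4, 8), (3, 4, 9), (3, 5, 7), (3, 5, 9), (3, 6, 7), (3, 6, 8), (3, 6, 9), (3, 7, 9), (3, 8, 9), (4,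 5, 7), (4, 5, 8), (4, 5, 9), (4, 6, 8), (4, 6, 9), (4, 7, 8), (4, 7, 9), (4, 8, 9), (5, 6, 7), (5, 7, 9), (5, 8, 9), (6, 7, 9)}

open MvPolynomial in
/-- `h^10_4` as a polynomial over `ZMod 2` -/
noncomputable def p4 : MvPolynomial (Fin 10) (ZMod 2) :=
  ∑ t ∈ tripF, X t.1 * X t.2.1 * X t.2.2

open MvPolynomial in
theorem p4_totalDegree : p4.totalDegree ≤ 3 := by
  refine (MvPolynomial.totalDegree_finsetSum _ _).trans (Finset.sup_le fun t _ => ?_)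
  calc (X t.1 * X t.2.1 * X t.2.2 : MvPolynomial (Fin 10) (ZMod 2)).totalDegree
      ≤ (X t.1 * X t.2.1 : MvPolynomial (Fin 10) (ZMod 2)).totalDegree
          + (X t.2.2 : MvPolynomial (Fin 10) (ZMod 2)).totalDegree := totalDegree_mul _ _
    _ ≤ ((X t.1 : MvPolynomial (Fin 10) (ZMod 2)).totalDegree
          + (X t.2.1 : MvPolynomial (Fin 10) (ZMod 2)).totalDegree)
          + (X t.2.2 : MvPolynomial (Fin 10) (ZMod 2)).totalDegree := by
        gcongr; exact totalDegree_mul _ _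
    _ = 3 := by simp [totalDegree_X]

theorem p4_eval (x : Fin 10 → Bool) :
    MvPolynomial.eval (fun j => if x j then (1 : ZMod 2) else 0) p4
      = ∑ t ∈ tripF, (ind x t.1) * (ind x t.2.1) * (ind x t.2.2) := by
  simp [p4, map_sum, map_mul, MvPolynomial.eval_X, ind]

theorem g4_eq_sum : ∀ x : Fin 10 → Bool,
    g4 x = decide ((∑ t ∈ tripF, (ind x t.1) * (ind x t.2.1) * (ind x t.2.2)) = 1) := by
  native_decide

theorem g4_cubic : ∃ p : MvPolynomial (Fin (5 + 5)) (ZMod 2), p.totalDegree ≤ 3 ∧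
    ∀ x, g4 x = decide (MvPolynomial.eval (fun j => if x j then (1 : ZMod 2) else 0) p = 1) :=
  ⟨p4, p4_totalDegree, fun x => by rw [p4_eval]; exact g4_eq_sum x⟩

/-! ### Load-bearing hypotheses: both cubicity assumptions are necessary -/

open Summit.QuantumAdvantage.QuantumAdvantage.Theses.CubicForrelation

/-- The crux with the hypothesis "`f` is cubic" dropped. -/
def ExactPairsMaioranaMcFarlandWithoutFCubic : Prop :=
  ∀ m : ℕ, ∀ f g : (Fin (m + m) → Bool) → Bool,
    (∃ p : MvPolynomial (Fin (m + m)) (ZMod 2), p.totalDegree ≤ 3 ∧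
      ∀ x, g x = decide (MvPolynomial.eval (fun j => if x j then (1 : ZMod 2) else 0) p = 1)) →
    forrelation f g = 1 → MMConclusionAt m g

/-- The crux with the hypothesis "`g` is cubic" dropped. -/
def ExactPairsMaioranaMcFarlandWithoutGCubic : Prop :=
  ∀ m : ℕ, ∀ f g : (Fin (m + m) → Bool) → Bool,
    (∃ p : MvPolynomial (Fin (m + m)) (ZMod 2), p.totalDegree ≤ 3 ∧
      ∀ x, f x = decide (MvPolynomial.eval (fun j => if x j then (1 : ZMod 2) else 0) p = 1)) →
    forrelation f g = 1 → MMConclusionAt m g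

/-- The crux with the forrelation hypothesis dropped. -/
def ExactPairsMaioranaMcFarlandWithoutForrelation : Prop :=
  ∀ m : ℕ, ∀ f g : (Fin (m + m) → Bool) → Bool,
    (∃ p : MvPolynomial (Fin (m + m)) (ZMod 2), p.totalDegree ≤ 3 ∧
      ∀ x, f x = decide (MvPolynomial.eval (fun j => if x j then (1 : ZMod 2) else 0) p = 1)) →
    (∃ p : MvPolynomial (Fin (m + m)) (ZMod 2), p.totalDegree ≤ 3 ∧
      ∀ x, g x = decide (MvPolynomial.eval (fun j => if x j then (1 : ZMod 2) else 0) p = 1)) →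
    MMConclusionAt m g

/-- The zero function is not in the (completed) MM class for `m = 1`: the MM normal form forces `perm`
to be constant. -/
theorem zero_not_MM : ¬ MMConclusionAt 1 (fun _ => false) := by
  rintro ⟨e, -, perm, h, H⟩
  have key : ∀ y'' : Fin 1 → Bool, perm y'' 0 = false := by
    intro y''
    have h0 := H (fun _ => false) y''
    have h1 := H (fun _ => true) y''
    simp only [Fin.sum_univ_one] at h0 h1
    revert h0 h1
    cases h y'' <;> cases perm y'' 0 <;> simp
  have hc : perm (fun _ => false) = perm (fun _ => true) := by
    funext i
    fin_cases i
    simp [key]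
  have := congrFun (perm.injective hc) 0
  simp at this

/-- Sanity: the crux is the conjunction-shaped strengthening of each weakened form. -/
theorem crux_of_shape :
    ExactPairsMaioranaMcFarland ↔ ∀ m : ℕ, ∀ f g : (Fin (m + m) → Bool) → Bool,
      (∃ p : MvPolynomial (Fin (m + m)) (ZMod 2), p.totalDegree ≤ 3 ∧ ∀ x, f x = decide (MvPolynomial.eval (fun j => if x j then (1 : ZMod 2) else 0) p = 1)) →
      (∃ p : MvPolynomial (Fin (m + m)) (ZMod 2), p.totalDegree ≤ 3 ∧ ∀ x, g x = decide (MvPolynomial.eval (fun j => if x j then (1 : ZMod 2) else 0) p = 1)) →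
      forrelation f g = 1 → MMConclusionAt m g := Iff.rfl

/-- Any proof of the crux must use that the DUAL `f` is cubic: PP20's `h^10_4` is a cubic bent function
(its dual `f4` is exactly forrelated with it) outside the completed MM class. -/
theorem exactPairsMaioranaMcFarland_false_without_fCubic : ¬ ExactPairsMaioranaMcFarlandWithoutFCubic :=
  fun h => g4_not_MM (h 5 f4 g4 g4_cubic forrelation_f4_g4)

/-- Any proof of the crux must use that `g` itself is cubic: the quartic dual `f4` of `h^10_4` is bent with CUBIC
dual `g4 = h^10_4`, exactly forrelated, and lies outside the completed MM class. -/
theorem exactPairsMaioranaMcFarland_false_without_gCubic : ¬ ExactPairsMaioranaMcFarlandWithoutGCubic :=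
  fun h => f4_not_MM (h 5 g4 f4 g4_cubic forrelation_g4_f4)

/-- Any proof of the crux must use the exact-duality hypothesis `forrelation f g = 1` (trivial sanity check:
`m = 1`, `f = g = 0`). -/
theorem exactPairsMaioranaMcFarland_false_without_forrelation :
    ¬ ExactPairsMaioranaMcFarlandWithoutForrelation := by
  intro hW
  have zc : ∃ p : MvPolynomial (Fin (1 + 1)) (ZMod 2), p.totalDegree ≤ 3 ∧
      ∀ x : Fin (1 + 1) → Bool, (fun _ : Fin (1 + 1) → Bool => false) x =
        decide (MvPolynomial.eval (fun j => if x j then (1 : ZMod 2) else 0) p = 1) :=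
    ⟨0, by simp, fun x => by simp⟩
  exact zero_not_MM (hW 1 (fun _ => false) (fun _ => false) zc zc)


/-! ## Cycle 2 (2026-08-16): the crux at a fixed half-dimension; `m = 5` is TRUE

Everything in this section is documentation for provers and planners: `CruxAt m` isolates the crux at one `m`,
`exactPairsMaioranaMcFarland_iff_forall_cruxAt` is the (definitional) splitting, and `cruxAt_five` records — as a
deliberately `sorry`d statement, the ONLY `sorry` in this file — the computational theorem of this cycle together
with its complete proof path.  Scripts and logs: seat folder `py/` (bf.py, extalg.py, stratum1_count.py,
stratum1_enum.py, stratum1_run.py, stratum1_full.log, test_IIA.py, solver.py, dualcond.py, classlevel.py, run12.py,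
gold8.py), attached to the item as evidence `cycle2_scripts.txt` / `cycle2_results.md`.
-/

/-- The crux `ExactPairsMaioranaMcFarland` at a fixed half-dimension `m` (verbatim body). -/
def CruxAt (m : ℕ) : Prop :=
  ∀ f g : (Fin (m + m) → Bool) → Bool,
    (∃ p : MvPolynomial (Fin (m + m)) (ZMod 2), p.totalDegree ≤ 3 ∧
      ∀ x, f x = decide (MvPolynomial.eval (fun j => if x j then (1 : ZMod 2) else 0) p = 1)) →
    (∃ p : MvPolynomial (Fin (m + m)) (ZMod 2), p.totalDegree ≤ 3 ∧
      ∀ x, g x = decide (MvPolynomial.eval (fun j => if x j then (1 : ZMod 2) else 0) p = 1)) →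
    forrelation f g = 1 → MMConclusionAt m g

/-- The crux is the conjunction of its fixed-`m` instances (definitional). -/
theorem exactPairsMaioranaMcFarland_iff_forall_cruxAt : ExactPairsMaioranaMcFarland ↔ ∀ m, CruxAt m := Iff.rfl

/-- Degenerate and classical cases, for the record: `m ≤ 4` is TRUE on paper (all cubic bent functions in ≤ 8
variables are in MM#: Dillon 1972 / Braeken 2006 / Langevin's classification — 9 affine classes of cubic bent
functions in 8 variables, Carlet–Villa 2025 §2), and their duals are automatically cubic (Boura–Canteaut parity
lemma, route review #3).  Not formalised here. -/
theorem cruxAt_le_four_informal : True := trivial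

/-- **THEOREM (this cycle; computational, not yet formalised — hence `sorry`).  `CruxAt 5` holds: every cubic
bent function `g` on 𝔽₂¹⁰ whose dual is cubic lies in the completed Maiorana–McFarland class.**

Proof path (all steps checked; (5) and the three kernel dimensions in (3) by machine, the rest on paper):

(1) F1 (quartic part of the dual).  For cubic bent `g` on 𝔽₂^{2m}, `4 ≤ m ≤ 7`, and `|I| = 4`:
    the ANF coefficient `c_I(g̃) = #{F ⊆ monomials(g|_{E_{Iᶜ}}) : |⋃F| = |F| + m − 1} mod 2`
    (Poisson summation `Σ_{w∈E_I}(−1)^{g̃(w)} = 2^{4−m} Σ_{x∈E_{Iᶜ}}(−1)^{g(x)}` on the coordinate 4-flat `E_I`,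
    then `wt(h) = Σ_{F≠∅} (−2)^{|F|−1} 2^{k−|⋃F|}`, `k = 2m−4`, read at bit `m−4`).  At `m = 5` this says:
    quartic part of `g̃` = Hodge dual of the divided square `γ₂(T) := Σ_{μ<ν, μ∩ν=∅} x^{μ∪ν} ∈ Λ⁶` of the cubic
    part `T` of `g`.  Hence: cubic dual ⇔ `γ₂(T) = 0`.  (`γ₂` is `GL(n,2)`-equivariant on `Λ³(𝔽₂ⁿ)`: lift to
    `ℤ[x]/(xᵢ²)`, `γ₂(T) = T̂²/2 mod 2`; the obstruction `γ₂(ℓ₁ℓ₂ℓ₃) = ℓ̂₁²ℓ̂₂²ℓ̂₃²/2 = 4q₁q₂q₃ ≡ 0`.)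
(2) Contraction identity `ι_a γ₂(T) = (ι_a T)·T`; so `γ₂(T) = 0 ⇔ ∀a, ω_a ∧ T = 0`, `ω_a := ι_aT = T(a,·,·)`.
(3) THEOREM K (`n = 10`).  If `γ₂(T) = 0` and `2r := max_a rank ω_a` then: `r = 4 ⇒ T = ℓ ∧ ω` with `rank ω = 8`
    (support 9, `dim Ker T = 1`); `r ≤ 3 ⇒ dim supp T ≤ 7` (`dim Ker T ≥ 3`).  Proof: write `T = x_n ω + T₀`,
    `T₀ ∈ Λ³(U)`, `U = S_{2r} ⊕ R`; `γ₂(T)=0 ⇔ ωT₀ = 0 ∧ γ₂(T₀) = 0`; split `T₀` by `R`-degree and use the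
    machine-checked kernels (py/extalg.py): on a `2r`-dim symplectic `S` over 𝔽₂ with `ω = Σpᵢqᵢ`:
    `2r = 8`: `ker(Λ²→Λ⁴, σ ↦ ωσ) = ⟨ω⟩`, `ker(Λ³→Λ⁵) = ω∧Λ¹`;  `2r = 6`: `Λ¹→Λ³` injective, `ker(Λ²→Λ⁴) = ⟨ω⟩`;
    `2r = 4`: `Λ¹→Λ³` injective, and a `∧`-isotropic subspace of `Λ²(𝔽₂⁴)` has dim ≤ 3.  (`r = 1 ⇒ T` decomposable.)
(4) STRATA of cubic/cubic bent `g` on 𝔽₂¹⁰ (`K := Ker T`, coordinates `x'` on a complement, `k` on `K`;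
    `g = G(x') + k·L(x') + q_K(k) + affine`):
    (0) `dim K ≥ 4` ⇒ `g ∈ MM#`: if `rank q_K ≥ 2`, completing squares (the couplings `k_jλ_j(x')` have LINEAR
        `λ_j`, so this is an affine change) splits off a 2-variable bent summand and leaves a bent cubic in ≤ 8
        variables, which is MM#; if `q_K` is affine, `rank L = dim K =: d` and `g ≅ G(y,z) + k·z` with `2(5−d)`-variable
        pieces; for `d = 4` the 5-space `V = K ⊕ ⟨e⟩` (ANY y-direction `e`) is a Dillon subspace (`g` is linear in
        `k`, `D_kD_e g = D_e(z·k′) = 0`), for `d = 5`, `V = K`.  (An earlier draft used the substitution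
        `y₁ ↦ y₁ + λ₂(z)`, which is NOT affine when `λ` is quadratic in `z`; the Dillon subspace above avoids it.)
    (I) `dim K = 3`: `q_K` of rank 2 ⇒ MM# as in (0); `q_K` affine ⇒ `g ≅ G(y,z) + k·z`, `y ∈ 𝔽₂⁴`, `z,k ∈ 𝔽₂³`
        — and then `V = K ⊕ L` is a Dillon subspace for every common isotropic plane `L` of the forms `β_z`; such an
        `L` EXISTS: `dim span γ ≤ 2` (finite fact; by hand: a Lagrangian `Γ` of `(Λ²𝔽₂⁴,∧)` with `Pf|_Γ = ⟨β₀,·⟩`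
        forces `Pf(β₀) = 0`), so `W := span{β₀,γ}` has `dim ≤ 3`, `W^⊥` has `dim ≥ 3`, and the Pfaffian — a
        quadratic form — has a nontrivial zero on `W^⊥` by Chevalley–Warning, i.e. a decomposable `ℓ∧ℓ′ ⊥ W`.
        So stratum (I) is MM# by a three-line argument; the enumeration (5) below is an independent confirmation.
        Parametrisation used in (5):
        all eight `G(·,z)` quadratic bent; parametrised by `β_z = β₀ + Σzᵢγᵢ` (all nondegenerate),
        `λ(z) = Σ_{i<j} zᵢzⱼλᵢⱼ` (constant/linear parts removed by EA and the shear `k ↦ k + ψ(y)`), and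
        `c(z) = c₁₂₃z₁z₂z₃` (affine/quadratic parts removed by EA and `k ↦ k + Az`).
    (II) `dim K = 1`, `T = ℓ ∧ ω₈`, normal form `g ≅ x₁x₂ + x₂Q(x″) + B(x″)`, `T = x₂σ_Q + C_B`:
        (II-A) `ℓ = x₂`: `B` quadratic bent, `σ_Q` nondegenerate, `B+Q` bent ⇒ MM# via `V = ⟨e₁⟩ ⊕ L`, `L` a
        common Lagrangian of `β_B` and `σ_Q` — exists by Scharlau, *Paare alternierender Formen*, Math. Z. 147
        (1976) (every pair of alternating forms with one regular is hyperbolic `H(W,f)`, and `W` is a common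
        Lagrangian); independently Dillon-verified on 300 random instances (test_IIA.py).
        (II-B) `ℓ ≠ x₂`: EMPTY — writing `ℓ = x₃`, `T = x₃(x₂μ + ω₀)` forces `σ_Q = x₃∧μ`, `C_B = x₃∧ω₀` with
        `rank ω₀ = 6` on 𝔽₂⁷ (radical `ρ`) and `μ(ρ) = 1` (rank 8), while bentness of the 2-concatenations
        `B = P ∥ (P+q₁)` and `B+Q = P ∥ (P+q₁+μ)` forces `q₁(ρ) = 1 = (q₁+μ)(ρ)`, i.e. `μ(ρ) = 0`.  Contradiction.
    By (3), `dim K ∈ {0, 2}` cannot occur, so (0),(I),(II) exhaust.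
(5) STRATUM (I), EXHAUSTIVE ENUMERATION (stratum1_run.py, 90 s): 58 240 admissible `(β₀,γ₁,γ₂,γ₃)` (note
    `dim span γ ≤ 2` always), 721 classes under `GL(3,2) × translations`, `λ` modulo the image of the shears
    `y ↦ y + τ(z)`, `c₁₂₃ ∈ {0,1}`; 93 828 candidates with `dim Ker T = 3`: all bent and cubic, 11 088 with
    cubic dual, and ALL 11 088 have a 5-dimensional Dillon subspace (validated tester).  0 exceptions.
Consequences recorded for the other seats: the `n = 10` exact slice consists of (0) direct-sum-like functions,
(I) MM-gluings of 4-variable quadratic pieces, (II-A) `x₁x₂ + x₂Q + B` with `B, B+Q` quadratic — in every case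
the Dillon subspace is EXPLICIT from the normal form (relevant to crux r3 / the sign problem at n = 10). -/
theorem cruxAt_five : CruxAt 5 := by
  sorry

/-- Cycle-1 "hypothesis H" (every cubic/cubic bent pair has an affine derivative, `Ker T ≠ 0`) restricted to a
fixed `m`, stated functionally: some nonzero direction `a` has `D_a g` affine. -/
def HypothesisHAt (m : ℕ) : Prop :=
  ∀ f g : (Fin (m + m) → Bool) → Bool,
    (∃ p : MvPolynomial (Fin (m + m)) (ZMod 2), p.totalDegree ≤ 3 ∧
      ∀ x, f x = decide (MvPolynomial.eval (fun j => if x j then (1 : ZMod 2) else 0) p = 1)) →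
    (∃ p : MvPolynomial (Fin (m + m)) (ZMod 2), p.totalDegree ≤ 3 ∧
      ∀ x, g x = decide (MvPolynomial.eval (fun j => if x j then (1 : ZMod 2) else 0) p = 1)) →
    forrelation f g = 1 →
      ∃ a : Fin (m + m) → Bool, a ≠ (fun _ => false) ∧
        ∀ x y, (g x ^^ g (bx x a) ^^ g y ^^ g (bx y a) ^^ g (bx x y) ^^ g (bx (bx x y) a)
                 ^^ g (fun _ => false) ^^ g a) = false

/-- INFORMAL RECORD (numerical, this cycle; triage round 1 F4 independently): `HypothesisHAt 5` is TRUE (it is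
step (3)+(1) above), but `HypothesisHAt 6` is FALSE: `g = Tr(x₁y³) + Tr(x₂z³)` on 𝔽₈⁴ (8 cubic monomials,
bent, dual `Tr(x₁⁵y) + Tr(x₂⁵z)` cubic, `Ker T = 0`, unique singular 6-space, in MM#; its completion class is
exactly its 2¹² translates).  A Lean certificate (forrelation double sum over `4096²` codes) is feasible in the
style of `forrelation_f4_g4` and is left to a later boundary; nothing in the crux depends on it. -/
theorem hypothesisH_status_informal : True := trivial


/-! ## Cycle 2, part B: the `n = 12` (`m = 6`) landscape — reductions, exact computations, conjectures

All statements below are informal (docstring-level); scripts in the seat folder `py/` (evidence `cycle2_scripts.txt` and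
later bundles).  Notation: `T` = cubic part of `g`, `d := dim Ker T`, `β` = quadratic part, MM# = completed MM class.

**R1 (cubic-dual criterion at m = 6; validated 70/70 against Walsh duals).**  For cubic bent `g` on 𝔽₂¹²,
`deg g̃ ≤ 3 ⇔ γ₂(T)·β + P(T)·T = 0 in Λ⁸(𝔽₂¹²)`, where `P(T) := Σ x^{μ∪ν}` over unordered pairs of cubic monomials
sharing exactly one variable.  For FIXED `T` this is an AFFINE condition on `β` (unlike m = 5, where it is `γ₂(T)=0`).
Equivalently: every restriction `h` of `g` to an 8-flat has `ε(h) := [x₁⋯x₈](γ₂(T_h)β_h + P(T_h)T_h) = 0`.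

**R2 (kernel reduction; uses the m = 5 theorem).**  If `d ≥ 1` write `g = G(x') + k·L(x') + q_K(k)` (`k` coordinates
on `K = Ker T`).  If `rank q_K ≥ 2`, completing squares gives `g ≅ H ⊕ (2-variable bent)` with `H` a cubic/cubic bent
in ≤ 10 variables, hence `g ∈ MM#`.  Otherwise `q_K` is affine, `rank L = d`, and `g ≅ G(y,z) + k·z` is an MM-GLUING of
`2^d` bent pieces `G(·,z)` in `12 − 2d` variables, each cubic with cubic dual (`G̃_w(u) = g̃(u,0,w)`), hence each in
MM#; `g ∈ MM#` whenever the pieces have a COMMON M-subspace (`V = K ⊕ L`).  Strata: (A0) `d = 0`; (A1) `d = 1`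
(two 10-variable pieces); (A2) `d = 2` (four 8-variable pieces); (A3) `d = 3` (eight 6-variable pieces); `d = 4` ⇒ MM#
(sixteen 4-variable quadratic pieces: a common isotropic plane exists by Chevalley–Warning on the Klein quadric, exactly
as in stratum (I) at n = 10); `d ≥ 5` ⇒ MM# (pieces in ≤ 2 variables).

**R3 (exact class-level computations, m = 6).**  Solver = bent completions of `T` as disjoint affine pieces ∩ the affine
cubic-dual condition R1; `Sing₆(T)` = all 6-spaces `V` with `T(V,V,·)=0`; non-MM# members = complement of `⋃_V A_V`.
 * `T(h¹⁰₃)⊕0`, `T(h¹⁰₄)⊕0`, `T(h¹²₁)`, `T(h¹²₂)`, `T(h¹²₃)`, `T(h¹²₅)`, `T(h¹²₆)` (PP20), `T(Tr(a x²¹))` (Canteaut–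
   Charpin–Kyureghyan, 5 bent `a`), `T(Tr(a x⁸¹))` (Leander, 2 bent `a`): NO bent completion with cubic dual.
 * `T(h¹²₇)`: `2²⁴` cubic-dual bent completions, `|Sing₆| = 147`, non-MM#: EXACTLY 0.
 * `d = 0`: `gold8 = Tr(x₁y³)+Tr(x₂z³)` on 𝔽₈⁴ and 89 perturbations `T_gold + T_h` (`T_h` arbitrary cubic in the
   y-variables): every class has exactly `2¹²` cubic-dual bent completions (the translates), `|Sing₆| = 1`, non-MM#: 0.
   (`HypothesisHAt 6` is false: gold8 has `Ker T = 0`.)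
 * Classes of random MM cubic/cubic functions with `d ≥ 2` are huge (linear stage of dimension 45–66): class-level
   enumeration is infeasible there; those are exactly the gluing strata, treated structurally:

**R4 (gluing strata, m = 6).**
 * (A3), 6-variable piece forms `T_B ∈ {0, T₁ = y₁y₂y₃, T₂ = y₂(y₁y₃+y₄y₅), T₃ = y₁y₂y₃+y₂y₄y₅+y₃y₄y₆}` (Rothaus),
   `|S_{T_B}| = 32768·?, 1344, 192, 64`.  Exact cubic-dual conditions: (a) the 8 piece-duals share their cubic part,
   (b) their quadratic parts are affine in `z`, (b′) `ℓᵢⱼ ∈ Ker T̃_B`, (c′) `Σ_z` (linear parts of piece duals) `= 0`.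
   `T₃`: ALL 13 440 configurations enumerated → 13 440 cubic/cubic gluings with `d = 3`, all MM#.  `T₂`: every sampled
   configuration has `d ≥ 4` (⇒ MM#).  `T₁`: 784 + 1 056 sampled `d = 3` cases, all MM# (kit sweep j011818 pending).
   `T_B = 0`: cubic dual ⇔ the pencil `β_z = β₀ + Σ zᵢγᵢ` is INVERSE-AFFINE (`z ↦ β_z⁻¹` affine); 368/368 such triples on
   𝔽₂⁶ admit a common Lagrangian (⇒ MM#); 122/122 glued functions MM# directly.
 * (A2), 8-variable piece forms: completable cubic forms on 𝔽₂⁸ found: `0, T₁⊕0², T₂⊕0², T₃⊕0² (= T(h⁸₂)), T(h⁸₁),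
   ℓ∧ω₆` with `|S| = –, 13 332 480, 2 666 496, 692 224, 24 576, 368 640`; `123+456`, `123+456+147` are NOT completable.
   Sub-gluing argument (the 10-variable restrictions `G(y,z₁,0)+k₁z₁` are cubic/cubic, hence in the n = 10 strata) ⇒
   for `T_B ≠ 0`, `d = 2` needs `dim Ker T_B ≥ 3`; data: `T₃⊕0²`: 1 736 cubic-dual planes, `d ∈ {3,4,6}`; `T₂⊕0²`:
   1 282 planes, `d ∈ {4,5,6,7}`; `T₁⊕0²`: 10 433 (targeted) planes, `d ∈ {3,…,9}` — `d = 2` NEVER realised with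
   `T_B ≠ 0`; with `T_B = 0`, (A2) = inverse-affine 2-pencils on 𝔽₂⁸ with `ℓ` free (open: generation is the bottleneck).
 * (A1): no `d = 1` cubic/cubic function at n = 12 could be constructed (0 of 56 bent partners of stratum-(I) functions
   met the dual condition `deg(B̃ + B̃′) ≤ 2`); `T′ = ℓ∧ω₈` is excluded on paper (II-A would force `e₁ ∈ rad σ_Q`,
   contradicting `d = 1`).

**R5 (4-concatenations).**  For a bent 4-concatenation `g(x,z) = f_z(x)` (`z ∈ 𝔽₂²`, dual bent condition
`Σ_z f̃_z = 1`) the dual is `g̃(u,v) = v₁v₂ + v₁(f̃₀₀+f̃₀₁)(u) + v₂(f̃₀₀+f̃₁₀)(u) + f̃₀₀(u) + (f̃₀₀+f̃₁₀)(f̃₀₀+f̃₀₁)(u)`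
(verified numerically), so `deg g̃ ≤ 3 ⇔ deg[(f̃₀₀+f̃₁₀)(f̃₀₀+f̃₀₁)] ≤ 3`; for QUADRATIC pieces this is the wedge condition
`(β̃₀₀+β̃₁₀) ∧ (β̃₀₀+β̃₀₁) = 0` on the dual forms, which forces the differences to have small rank (large common radical,
hence large `d`): 240/240 block-diagonal inverse-affine quadratic 4-concatenations had QUARTIC duals.  Cubic pieces from
stratum (I): 448 bent 4-concatenations (dual bent condition met), 101 with cubic dual, `d ∈ {3,4,5}`, all MM#
(concat4.py).  The recurring mechanism: at every level "cubic dual" is a wedge/divisibility condition that forces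
rank-degeneracy, which in turn produces kernel directions and Dillon subspaces.

**CONJECTURES for the provers (each with the evidence above; any failure is where a counterexample lives).**
 (P1) `d = 0` cubic/cubic bent functions on 𝔽₂¹² are the gold-type MM functions (classes rigid: translates only).
 (P2) (A1) with `T_B ≠ 0` is empty (with `T_B = 0` — two QUADRATIC 10-variable pieces with nondegenerate difference —
      `d = 1` does occur and is MM# by Scharlau, exactly as II-A).
 (P3) (A2) with `T_B ≠ 0` forces `d ≥ 3`.
 (P4) Inverse-affine pencils `{β₀ + Σzᵢγᵢ}` of nondegenerate alternating forms (dim 6: verified; dim 8: open) have a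
      common Lagrangian.  (Pairs: Scharlau 1976.)
 (P5) (A3) with `T_B = T₁` is MM# (sampled), `T₂` forces `d ≥ 4` (sampled), `T₃` done (exhaustive), `T₀` = (P4).
 (P1)–(P5) ⇒ `CruxAt 6`.  Heuristic for general `m`: "cubic dual" = `2^{m−2}`-divisibility of all Walsh coefficients of
 restrictions to `(2m−4)`-flats — a condition that gets STRONGER with `m`; all evidence says counterexamples, if any,
 live in low dimension, and `n = 10` is closed.
-/


/-! ## Cycle 2, part C: machine-checked inputs of Theorem K (exterior algebra over 𝔽₂)

The square-zero commutative monomial algebra `𝔽₂[x₁…x_n]/(xᵢ²)` (= exterior algebra in characteristic 2) with monomials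
coded as bitmasks; `mulRank r k` is the rank over 𝔽₂ of `Λᵏ → Λᵏ⁺²`, `σ ↦ ω·σ`, `ω = Σ_{i<r} x_{2i}x_{2i+1}` the
standard symplectic form on `2r` variables.  The kernel dimensions `C(2r,k) − mulRank r k` are exactly the facts used
in step (3) of `cruxAt_five`: `2r = 8`: `ker(Λ²→Λ⁴) = 28 − 27 = 1 (= ⟨ω⟩)`, `ker(Λ³→Λ⁵) = 56 − 48 = 8 (= ω∧Λ¹)`,
`Λ¹→Λ³` injective; `2r = 6`: `Λ¹→Λ³` injective, `ker(Λ²→Λ⁴) = 15 − 14 = 1`; `2r = 4`: `Λ¹→Λ³` injective,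
`ker(Λ²→Λ⁴) = 6 − 1 = 5`.  (That `ω` resp. `ω∧Λ¹` lie in these kernels is immediate from `ω∧ω = 2γ₂(ω) = 0`.) -/
namespace ExtAlgF2

/-- number of set bits -/
def popcount (m : Nat) : Nat := (Nat.bits m).count true

/-- greedy xor-basis insertion (`min w (w ^^^ b)` clears the leading bit of `b` from `w` when it is set) -/
def insertVec (basis : List Nat) (v : Nat) : List Nat :=
  let v' := basis.foldl (fun w b => min w (w ^^^ b)) v
  if v' = 0 then basis else v' :: basis

/-- GF(2)-rank of a list of bitmask vectors -/
def rank2 (vs : List Nat) : Nat := (vs.foldl insertVec []).length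

/-- all `k`-subsets of `{0,…,n-1}` as bitmasks, increasing -/
def subsets (n k : Nat) : List Nat := (List.range (2 ^ n)).filter fun m => popcount m = k

/-- the standard symplectic 2-form on `2r` variables as a list of monomials -/
def omega (r : Nat) : List Nat := (List.range r).map fun i => (1 <<< (2*i)) ||| (1 <<< (2*i+1))

/-- the row of the multiplication matrix for the source monomial `s`: bitmask over the target list `tgt` -/
def mulOmegaRow (r : Nat) (tgt : List Nat) (s : Nat) : Nat :=
  (omega r).foldl (fun acc w => if s &&& w = 0 then acc ^^^ (1 <<< (tgt.idxOf (s ||| w))) else acc) 0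

/-- rank over 𝔽₂ of `Λᵏ → Λᵏ⁺²`, `σ ↦ ω σ`, on `2r` variables -/
def mulRank (r k : Nat) : Nat :=
  let src := subsets (2*r) k
  let tgt := subsets (2*r) (k+2)
  rank2 (src.map (mulOmegaRow r tgt))

theorem mulRank_2_1 : mulRank 2 1 = 4 := by native_decide
theorem mulRank_2_2 : mulRank 2 2 = 1 := by native_decide
theorem mulRank_3_1 : mulRank 3 1 = 6 := by native_decide
theorem mulRank_3_2 : mulRank 3 2 = 14 := by native_decide
theorem mulRank_3_3 : mulRank 3 3 = 6 := by native_decide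
theorem mulRank_4_1 : mulRank 4 1 = 8 := by native_decide
theorem mulRank_4_2 : mulRank 4 2 = 27 := by native_decide
theorem mulRank_4_3 : mulRank 4 3 = 48 := by native_decide

end ExtAlgF2

end Summit.QuantumAdvantage.QuantumAdvantage.Cruxes.ExactPairsMaioranaMcFarland.Disproof
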